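import Summits.ResolutionOfSingularities.ResolutionOfSingularities.Theorems.EquisingularLiftEquisingularLiftReducedStalkOverIso
import Literature.AlgebraicGeometry.Resolution.ResolutionGlue
import Literature.AlgebraicGeometry.Resolution.Blowups
import Literature.AlgebraicGeometry.Resolution.BlowupsProperProofs
import HarnessLib

/-!
# [OURS · L1 W4.5(b) · EL♮] An `x`-AVOIDING chain is an ISOMORPHISM over a neighbourhood of `x` — the first touch sees
# the level-0 geometry at `x` (any `n`, any base)
# (crux `EquisingularLiftNat` = stmt-ResolutionOfSingularities-20038; object T-AVOID-ISO, K-∀n / necessity lane)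

HONEST FRAMING. OURS (cell res-hironaka, crux chain w45b, slot W4.5(b)); NOT a statement of any manuscript; replaces the role
of NOTHING in the manuscript; AI-written, AI review is weaker than expert review. Helper `--supports
stmt-ResolutionOfSingularities-20038 --as helper`. The dictionary line behind every FIRST-TOUCH analysis (res-L1-w45b-lead-2
LEAD-MEMO-1 §3 at `n = 3`; res-D-brk-4 K5-BMY STEP 0 / SKELETON v1 at `n = 5`: «`R := 𝒪_{H_i, η_{S_i}} ≅ 𝒪_{H, η_S}` — the
avoiding prefix is an iso near `η_S`»): the stage `(X₀, σ₀, Y₀)` that `ULTAt` / `ULTFlatAt` (p512565) produce lies in the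
`x`-AVOIDING closure, and such a chain does not change anything over a Zariski neighbourhood of `x`.

* `exists_isIso_restrict_of_avoidingChain` — for `(X₀, σ₀, Y₀)` in the `x`-avoiding E1-closure of `(P, 𝟙, Y)` (`P` locally Noetherian, `Y` closed;
  the TYPED avoiding closure of `ULTAt`, so the horizontal one of `ULTFlatAt` a fortiori, `…_of_horizAvoidingChain`): `Y₀` is
  closed and there is an open `U ∋ x` of `P` with `σ₀ ∣_ U` an ISOMORPHISM and `Y₀ ∩ σ₀⁻¹U = σ₀⁻¹(Y ∩ U)` (the strict
  transform equals the total transform over `U`). Induction: `U ↦ U ∖ σ′(supp C)` (closed image: `σ′` proper), the blow-up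
  is an isomorphism off its centre (`IsBlowup.isIso_morphismRestrict`), isos restrict (`isIso_morphismRestrict_of_le`).
* `isIso_stalkMap_of_avoidingChain` — hence `σ₀` induces an isomorphism of local rings `𝒪_{P, σ₀ x₀} ≅ 𝒪_{X₀, x₀}` at every
  point `x₀` over `U`, in particular at the point over `x`;
* `isRegularLocalRing_iff_of_avoidingChain` — and the reduced strict transform `V(closure Y₀)` is regular at a point over
  `U` iff `V(closure Y)` is regular at its image (`stub_reducedStalkOverIso`): the first touch meets the ORIGINAL singularity.

References: GW I Prop. 13.91 (3) [GortzWedhorn2020]; tree `Literature…Blowups` (`IsBlowup.isIso_morphismRestrict`),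
`Literature…ResolutionGlue` (`isIso_morphismRestrict_of_le`), `…ReducedStalkOverIso` (`stub_reducedStalkOverIso`), Mathlib
`morphismRestrict_comp`, `morphismRestrictStalkMap`.
-/

set_option linter.dupNamespace false -- mandated namespace `Summit.<Summit>.<Problem>` of this single-conjunct summit

open CategoryTheory AlgebraicGeometry TopologicalSpace Topology
open Literature.AlgebraicGeometry.Resolution
open AlgebraicGeometry.Scheme.IdealSheafData
open Summit.ResolutionOfSingularities.ResolutionOfSingularities.Cruxes.EquisingularLift.StrataSplit

namespace Summit.ResolutionOfSingularities.ResolutionOfSingularities.Cruxes.EquisingularLiftNat.Sections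

/-- **An `x`-avoiding chain is an isomorphism over a neighbourhood of `x`.** Let `O` be a local ring, `q : P → Spec O`,
`Y ⊆ P` closed, `x ∈ P`, and `(X₀, σ₀, Y₀)` in the inductive closure of `(P, 𝟙, Y)` under the item's E1 blow-up steps whose
centres AVOID `x` (`x ∉ σ′(supp C)`; the typed avoiding closure of `ULTAt`). Then `Y₀` is closed and for some open `U ∋ x`
the restriction `σ₀ ∣_ U : σ₀⁻¹U → U` is an isomorphism and `Y₀ ∩ σ₀⁻¹U = σ₀⁻¹(Y ∩ U)`. [folklore; GW I Prop. 13.91 (3)] -/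
theorem exists_isIso_restrict_of_avoidingChain {O : Type} [CommRing O] [IsLocalRing O]
    {P : AlgebraicGeometry.Scheme.{0}} [AlgebraicGeometry.IsLocallyNoetherian P] (q : P ⟶ AlgebraicGeometry.Spec (.of O))
    {Y : Set P} (hY : IsClosed Y) {x : P}
    {X₀ : AlgebraicGeometry.Scheme.{0}} {σ₀ : X₀ ⟶ P} {Y₀ : Set X₀}
    (hav : (∀ Q : (∀ X' : AlgebraicGeometry.Scheme.{0}, (X' ⟶ P) → Set X' → Prop), Q P (CategoryTheory.CategoryStruct.id _) Y → (∀ (X' X'' : AlgebraicGeometry.Scheme.{0}) (σ' : X' ⟶ P) (Y' : Set X') (C : X'.IdealSheafData) (τ : X'' ⟶ X'), Q X' σ' Y' → Literature.AlgebraicGeometry.Resolution.IsBlowup τ C → Literature.AlgebraicGeometry.Resolution.Scheme.IsRegular C.subscheme → σ' '' (C.support : Set X') ⊆ {x | ¬ IsGenericPoint x Y} → (C.support : Set X') ∩ (CategoryTheory.CategoryStruct.comp σ' q) ⁻¹' {IsLocalRing.closedPoint O} ⊆ Y' → x ∉ σ' '' (C.support : Set X') → Q X'' (CategoryTheory.CategoryStruct.comp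 τ σ') (closure (τ ⁻¹' (Y' \ (C.support : Set X'))))) → Q X₀ σ₀ Y₀)) :
    IsClosed Y₀ ∧ ∃ U : P.Opens, x ∈ U ∧ CategoryTheory.IsIso (σ₀ ∣_ U) ∧ Y₀ ∩ σ₀ ⁻¹' (U : Set P) = σ₀ ⁻¹' (Y ∩ (U : Set P)) := by
  have key := hav (fun X' σ' Y' => (IsLocallyNoetherian X' ∧ IsProper σ') ∧ IsClosed Y' ∧
      ∃ U : P.Opens, x ∈ U ∧ IsIso (σ' ∣_ U) ∧ Y' ∩ σ' ⁻¹' (U : Set P) = σ' ⁻¹' (Y ∩ (U : Set P))) ?_ ?_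
  · exact key.2
  · refine ⟨⟨inferInstance, inferInstance⟩, hY, ⊤, trivial, ?_, ?_⟩
    · rw [morphismRestrict_id]; exact IsIso.id _
    · ext v; simp
  · rintro X' X'' σ' Y' C τ ⟨⟨hN, hprop⟩, hY'cl, U, hxU, hiso, hYU⟩ hbl - - - hxC
    haveI := hN
    haveI := hprop
    haveI : IsProper τ := hbl.isProper
    haveI : IsLocallyNoetherian X'' := LocallyOfFiniteType.isLocallyNoetherian τ
    refine ⟨⟨inferInstance, inferInstance⟩, isClosed_closure, ?_⟩
    -- shrink `U` away from the (closed) image of the centre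
    have hcl : IsClosed (σ' '' (C.support : Set X')) := σ'.isClosedMap _ C.support.isClosed
    let U'' : P.Opens := ⟨(U : Set P) ∩ (σ' '' (C.support : Set X'))ᶜ, U.2.inter hcl.isOpen_compl⟩
    have hU''U : U'' ≤ U := fun y hy => hy.1
    refine ⟨U'', ⟨hxU, hxC⟩, ?_, ?_⟩
    · -- `(τ ≫ σ') ∣_ U'' = τ ∣_ σ'⁻¹U'' ≫ σ' ∣_ U''`, both isomorphisms
      rw [morphismRestrict_comp]
      haveI h1 : IsIso (σ' ∣_ U'') := isIso_morphismRestrict_of_le σ' hiso hU''U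
      haveI h2 : IsIso (τ ∣_ σ' ⁻¹ᵁ U'') := hbl.isIso_morphismRestrict (by
        rw [Set.disjoint_left]
        rintro y ⟨-, hy⟩ hyC
        exact hy ⟨y, hyC, rfl⟩)
      exact @IsIso.comp_isIso _ _ _ _ _ (τ ∣_ σ' ⁻¹ᵁ U'') (σ' ∣_ U'') h2 h1
    · -- the strict transform equals the total transform over `U''`
      have hW : ((CategoryTheory.CategoryStruct.comp τ σ') ⁻¹' (U'' : Set P)) = τ ⁻¹' (σ' ⁻¹' (U'' : Set P)) := by
        ext v; simp only [Set.mem_preimage, Scheme.Hom.comp_apply]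
      have hW' : ((CategoryTheory.CategoryStruct.comp τ σ') ⁻¹' (Y ∩ (U'' : Set P))) =
          τ ⁻¹' (σ' ⁻¹' (Y ∩ (U'' : Set P))) := by
        ext v; simp only [Set.mem_preimage, Scheme.Hom.comp_apply]
      have hYU'' : Y' ∩ σ' ⁻¹' (U'' : Set P) = σ' ⁻¹' (Y ∩ (U'' : Set P)) := by
        ext y
        constructor
        · rintro ⟨hy, hyU⟩
          have h : y ∈ Y' ∩ σ' ⁻¹' (U : Set P) := ⟨hy, hU''U hyU⟩
          rw [hYU] at h
          exact ⟨h.1, hyU⟩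
        · rintro ⟨hyY, hyU⟩
          have h : y ∈ σ' ⁻¹' (Y ∩ (U : Set P)) := ⟨hyY, hU''U hyU⟩
          rw [← hYU] at h
          exact ⟨h.1, hyU⟩
      rw [hW, hW', ← hYU'', Set.preimage_inter]
      apply le_antisymm
      · rintro v ⟨hv, hvU⟩
        have hsub : closure (τ ⁻¹' (Y' \ (C.support : Set X'))) ⊆ τ ⁻¹' Y' :=
          closure_minimal (fun w hw => hw.1) (hY'cl.preimage τ.base.hom.continuous)
        exact ⟨hsub hv, hvU⟩
      · rintro v ⟨hvY, hvU⟩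
        refine ⟨subset_closure ⟨hvY, fun hvC => ?_⟩, hvU⟩
        exact hvU.2 ⟨τ v, hvC, rfl⟩

/-- The same for the HORIZONTAL `x`-avoiding closure of `ULTFlatAt` (p512565): a closure under MORE step hypotheses lies in
the closure under fewer. [folklore] -/
theorem exists_isIso_restrict_of_horizAvoidingChain {O : Type} [CommRing O] [IsLocalRing O]
    {P : AlgebraicGeometry.Scheme.{0}} [AlgebraicGeometry.IsLocallyNoetherian P] (q : P ⟶ AlgebraicGeometry.Spec (.of O))
    {Y : Set P} (hY : IsClosed Y) {x : P}
    {X₀ : AlgebraicGeometry.Scheme.{0}} {σ₀ : X₀ ⟶ P} {Y₀ : Set X₀}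
    (hav : (∀ Q : (∀ X' : AlgebraicGeometry.Scheme.{0}, (X' ⟶ P) → Set X' → Prop), Q P (CategoryTheory.CategoryStruct.id _) Y → (∀ (X' X'' : AlgebraicGeometry.Scheme.{0}) (σ' : X' ⟶ P) (Y' : Set X') (C : X'.IdealSheafData) (τ : X'' ⟶ X'), Q X' σ' Y' → Literature.AlgebraicGeometry.Resolution.IsBlowup τ C → Literature.AlgebraicGeometry.Resolution.Scheme.IsRegular C.subscheme → AlgebraicGeometry.Flat (CategoryTheory.CategoryStruct.comp C.subschemeι (CategoryTheory.CategoryStruct.comp σ' q)) → σ' '' (C.support : Set X') ⊆ {x | ¬ IsGenericPoint x Y} → (C.support : Set X') ∩ (CategoryTheory.CategoryStruct.comp σ' q) ⁻¹' {IsLocalRing.closedPoint O} ⊆ Y' → x ∉ σ' '' (C.support : Set X') → Q X'' (CategoryTheory.CategoryStruct.comp τ σ') (closure (τ ⁻¹' (Y' \ (C.support : Set X'))))) → Q X₀ σ₀ Y₀)) :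
    IsClosed Y₀ ∧ ∃ U : P.Opens, x ∈ U ∧ CategoryTheory.IsIso (σ₀ ∣_ U) ∧ Y₀ ∩ σ₀ ⁻¹' (U : Set P) = σ₀ ⁻¹' (Y ∩ (U : Set P)) :=
  exists_isIso_restrict_of_avoidingChain q hY (fun Q h0 hs => hav Q h0
    (fun X' X'' σ' Y' C τ hQ hbl hC _ hg hE hxc => hs X' X'' σ' Y' C τ hQ hbl hC hg hE hxc))

/-- **Local rings are unchanged over the neighbourhood.** If `σ₀ ∣_ U` is an isomorphism, `σ₀` induces an isomorphism of
stalks `𝒪_{P, σ₀ x₀} → 𝒪_{X₀, x₀}` at every point `x₀` over `U` (Mathlib `morphismRestrictStalkMap`). [folklore] -/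
theorem isIso_stalkMap_of_isIso_restrict {P X₀ : AlgebraicGeometry.Scheme.{0}} (σ₀ : X₀ ⟶ P) (U : P.Opens)
    (hiso : IsIso (σ₀ ∣_ U)) {x₀ : X₀} (hx₀ : σ₀ x₀ ∈ U) : IsIso (σ₀.stalkMap x₀) := by
  have h1 : IsIso ((σ₀ ∣_ U).stalkMap ⟨x₀, hx₀⟩) := inferInstance
  exact ((MorphismProperty.isomorphisms CommRingCat).arrow_mk_iso_iff
    (morphismRestrictStalkMap σ₀ U ⟨x₀, hx₀⟩)).mp h1

/-- **The first touch meets the original singularity.** In the setting of `exists_isIso_restrict_of_avoidingChain`, for the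
open `U` it provides: a point `z` of the reduced strict transform `V(closure Y₀)` lying over `U` is regular iff the point of
`V(closure Y)` under it is regular (`stub_reducedStalkOverIso`). [folklore] -/
theorem isRegularLocalRing_iff_of_isIso_restrict {P X₀ : AlgebraicGeometry.Scheme.{0}} (σ₀ : X₀ ⟶ P) {Y : Set P}
    (hY : IsClosed Y) {Y₀ : Set X₀} (hY₀ : IsClosed Y₀) (U : P.Opens) (hiso : IsIso (σ₀ ∣_ U))
    (hYU : Y₀ ∩ σ₀ ⁻¹' (U : Set P) = σ₀ ⁻¹' (Y ∩ (U : Set P)))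
    (z : ↥(AlgebraicGeometry.Scheme.IdealSheafData.vanishingIdeal (⟨closure Y₀, isClosed_closure⟩ : TopologicalSpace.Closeds X₀)).subscheme)
    (w : ↥(AlgebraicGeometry.Scheme.IdealSheafData.vanishingIdeal (⟨closure Y, isClosed_closure⟩ : TopologicalSpace.Closeds P)).subscheme)
    (hzw : σ₀ ((AlgebraicGeometry.Scheme.IdealSheafData.vanishingIdeal (⟨closure Y₀, isClosed_closure⟩ : TopologicalSpace.Closeds X₀)).subschemeι z) = (AlgebraicGeometry.Scheme.IdealSheafData.vanishingIdeal (⟨closure Y, isClosed_closure⟩ : TopologicalSpace.Closeds P)).subschemeι w)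
    (hwU : ((AlgebraicGeometry.Scheme.IdealSheafData.vanishingIdeal (⟨closure Y, isClosed_closure⟩ : TopologicalSpace.Closeds P)).subschemeι w : P) ∈ U) :
    IsRegularLocalRing ((AlgebraicGeometry.Scheme.IdealSheafData.vanishingIdeal (⟨closure Y₀, isClosed_closure⟩ : TopologicalSpace.Closeds X₀)).subscheme.presheaf.stalk z) ↔
      IsRegularLocalRing ((AlgebraicGeometry.Scheme.IdealSheafData.vanishingIdeal (⟨closure Y, isClosed_closure⟩ : TopologicalSpace.Closeds P)).subscheme.presheaf.stalk w) := by
  refine stub_reducedStalkOverIso P X₀ σ₀ U hiso ⟨closure Y, isClosed_closure⟩ ⟨closure Y₀, isClosed_closure⟩ ?_ z w hzw hwU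
  show closure Y₀ ∩ σ₀ ⁻¹' (U : Set P) = σ₀ ⁻¹' (closure Y) ∩ σ₀ ⁻¹' (U : Set P)
  rw [hY₀.closure_eq, hY.closure_eq, hYU, Set.preimage_inter]

end Summit.ResolutionOfSingularities.ResolutionOfSingularities.Cruxes.EquisingularLiftNat.Sections
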